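import Literature.Computability.ImplicitComplexity.STASubstLower
import Literature.Computability.ImplicitComplexity.STASubstExpand
import HarnessLib

/-!
# The weighted substitution lemma for `STA` (GR07 Lemma 4.3 / GMR08 Lemma 3.4)

Support file for the `PTIME` soundness half of `STACapturesP` (GMR08 Thm. 3.5). The heart of
"the weight of a proof decreases when a β-reduction is performed" (GMR08 §3.1) is the
substitution lemma of [GR07]: from `Π ▹ Γ, x : μ ⊢ M : σ` and `Σ ▹ Δ ⊢ N : μ` with `Γ # Δ` one
builds `S(Σ, Π) ▹ Γ, Δ ⊢ M[N/x] : σ` with `W(S(Σ,Π), r) ≤ W(Π, r) + W(Σ, r)` for `r ≥ rk(Π)`,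
by induction on `Π`, duplicating the box of `N` below multiplexors. We prove it in the
simultaneous form prepared in `STASubstData.lean`:

* `MTyping.substitution` — if `Θ ⊢ P : μ` with degree `d ≤ D`, ranks `≤ r`, weight `w`, and
  `(θ, Δ, cost)` is typed substitution data out of `Θ` (every slot renamed at cost `0` or
  substituted by a derivation of degree `≤ D` and weight `cost i`, pieces pairwise disjoint),
  then `⋃ᵢ Δ i ⊢ P[θ] : μ` is derivable with degree `≤ D`, ranks `≤ r` and weight
  `≤ w + ∑ᵢ cost i`.

The eight cases are GR07's: `(Ax)` uses the datum of the variable; `(w)` and `(⊸E)` restrict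
the data (`SubstData.restrict`); `(⊸I)` shifts them (`SubstData.up`); `(∀I)`/`(∀E)` commute
(`SubstData.shiftT`); `(sp)` opens the boxes of all substituted terms (`SubstData.lower`,
Property 1) and re-promotes, the factor `r` of the weight absorbing the costs; `(m)` duplicates
the box of the contracted variable into `≤ r` renamed-apart copies and contracts their contexts
back (`SubstData.expand`).

## References

* [GaboardiMarionRonchidellarocca2008] GMR08, §3.1, Lemma 3.4, Def. A.1.
* [GaboardiRonchiDellaRocca2007] GR07, Lemma 4.3 (Substitution) and its weighted form.
-/

namespace Literature.Computability.ImplicitComplexity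

namespace STA

namespace MTyping

/-- **Weighted substitution lemma** (GR07 Lemma 4.3, GMR08 Lemma 3.4, simultaneous de Bruijn
form). Let `Θ ⊢ P : μ` be derivable with degree `d ≤ D`, multiplexor ranks `≤ r` and weight `w`,
and let `(θ, Δ, cost)` be typed substitution data out of `Θ` with degrees `≤ D`
(`SubstData`). Then `⋃ᵢ Δ i ⊢ P[θ] : μ` is derivable with degree `≤ D`, ranks `≤ r`, and weight
at most `w + ∑_{i<n} cost i` for any bound `n` of the support of `Θ`: substituting derivations
for variables costs at most their weights, even though boxes get duplicated below multiplexors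
(the factor `r` in `W((sp) Σ, r) = r · W(Σ, r)` pays for the `≤ r` copies).
[cite: GaboardiMarionRonchidellarocca2008, Lemma 3.4 and §3.1] -/
theorem substitution {r d w : ℕ} {Θ : Ctx} {P : Term} {μ : SoftTy} (hP : MTyping r w d Θ P μ)
    {D : ℕ} {θ : ℕ → Term} {Δ : ℕ → Ctx} {cost : ℕ → ℕ} {n : ℕ} (hd : d ≤ D)
    (hS : SubstData r D Θ θ Δ cost) (hn : Θ.BoundedBy n) :
    ∃ d' w', d' ≤ D ∧ w' ≤ w + (Finset.range n).sum cost ∧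
      MTyping r w' d' (Ctx.iUnion Δ) (P.substp θ) μ := by
  induction hP generalizing D θ Δ cost n with
  | @ax Γ i₀ A hs =>
    obtain ⟨m, hm⟩ := hS.bdd
    have hbU := Ctx.iUnion_boundedBy hm
    have hle : ∀ k, Δ i₀ k ≠ none → Ctx.iUnion Δ k = Δ i₀ k := fun k hk =>
      Ctx.iUnion_apply hS.disj hk
    have hi₀n : i₀ < n := by
      by_contra hc
      have := hn i₀ (by omega)
      rw [hs.1] at this
      cases this
    rcases hS.slot i₀ ⟨0, A⟩ hs.1 with ⟨i', hθ, hsing, -⟩ | ⟨dᵢ, hdᵢ, hder⟩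
    · refine ⟨0, 1, Nat.zero_le _, by omega, ?_⟩
      simp only [Term.substp, hθ]
      exact (MTyping.ax hsing).extend hle hbU
    · refine ⟨dᵢ, cost i₀, hdᵢ, ?_, ?_⟩
      · have : cost i₀ ≤ (Finset.range n).sum cost :=
          Finset.single_le_sum (f := cost) (fun _ _ => Nat.zero_le _) (Finset.mem_range.2 hi₀n)
        omega
      · simp only [Term.substp]
        exact hder.extend hle hbU
  | @weak d w Γ₀ Γ M τ j A h₀ hj hΓ ih =>
    have hle : ∀ i, Γ₀ i ≠ none → Γ₀ i = Γ i := by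
      intro i hi
      have hij : i ≠ j := fun e => by subst e; exact hi hj
      rw [hΓ, Function.update_of_ne hij]
    have hn₀ : Γ₀.BoundedBy n := fun i hi => by
      by_contra hne
      have := hn i hi
      rw [← hle i hne] at this
      exact hne this
    obtain ⟨d', w', hd', hw', hder⟩ := ih hd (hS.restrict hle) hn₀
    refine ⟨d', w', hd', hw'.trans (Nat.add_le_add_left (SubstData.sum_restrictCost_le _ _ _) _),
      ?_⟩
    obtain ⟨m, hm⟩ := hS.bdd
    exact hder.extend (fun i' hi' => hS.iUnion_restrict_le Γ₀ i' hi') (Ctx.iUnion_boundedBy hm)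
  | @lam d w Γ M k B A h₀ ih =>
    have hn' : (Ctx.cons (some ⟨k, B⟩) Γ).BoundedBy (n + 1) := fun i hi => by
      cases i with
      | zero => omega
      | succ i => exact hn i (by omega)
    obtain ⟨d', w', hd', hw', hder⟩ := ih hd (hS.up ⟨k, B⟩) hn'
    rw [hS.iUnion_upΔ, SubstData.sum_upCost] at *
    exact ⟨d', w' + 1, hd', by omega, MTyping.lam hder⟩
  | @app d₁ d₂ w₁ w₂ Γ Γ₁ Γ₂ M N k B A hs h₁ h₂ ih₁ ih₂ =>
    have hle₁ : ∀ i, Γ₁ i ≠ none → Γ₁ i = Γ i := fun i hi => by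
      rcases hs i with ⟨e, -⟩ | ⟨e, -⟩
      · exact e
      · exact absurd e hi
    have hle₂ : ∀ i, Γ₂ i ≠ none → Γ₂ i = Γ i := fun i hi => by
      rcases hs i with ⟨-, e⟩ | ⟨-, e⟩
      · exact absurd e hi
      · exact e
    have hn₁ : Γ₁.BoundedBy n := fun i hi => by
      by_contra hne; have := hn i hi; rw [← hle₁ i hne] at this; exact hne this
    have hn₂ : Γ₂.BoundedBy n := fun i hi => by
      by_contra hne; have := hn i hi; rw [← hle₂ i hne] at this; exact hne this
    obtain ⟨d₁', w₁', hd₁', hw₁', hder₁⟩ := ih₁ (le_of_max_le_left hd) (hS.restrict hle₁) hn₁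
    obtain ⟨d₂', w₂', hd₂', hw₂', hder₂⟩ := ih₂ (le_of_max_le_right hd) (hS.restrict hle₂) hn₂
    refine ⟨max d₁' d₂', w₁' + w₂' + 1, max_le hd₁' hd₂', ?_,
      MTyping.app (hS.split_iUnion hs) hder₁ hder₂⟩
    have := hS.sum_restrictCost_split hs n
    omega
  | @mpx d w Γ₀ Γ M₀ M μ σ S j h₀ hSσ hj hr hΓ hM ih =>
    rw [hΓ] at hS hn
    obtain ⟨θ₀, Δ₀, cost₀, hSD, hcost, hfin⟩ := SubstData.expand hSσ hj hr hS
    obtain ⟨n₀, hn₀⟩ := h₀.exists_boundedBy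
    obtain ⟨d', w', hd', hw', hder⟩ :=
      ih (n := max n n₀) hd hSD (hn₀.mono (le_max_right n n₀))
    refine ⟨d', w', hd', ?_, ?_⟩
    · have h1 := hcost (max n n₀) (hn.mono (le_max_left n n₀)) (hn₀.mono (le_max_right n n₀))
      have h2 : (Finset.range (max n n₀)).sum cost = (Finset.range n).sum cost :=
        Finset.eventually_constant_sum (fun i hi => hS.cost_eq_zero (hn i hi)) (le_max_left n n₀)
      omega
    · rw [hM]
      exact hfin d' w' M₀ μ (fun i hi => h₀.isSome_of_freeIn hi) hder
  | @sp d w Γ₀ Γ M k A h₀ hΓ ih =>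
    rw [hΓ] at hS hn
    obtain ⟨Δ', cost', hSD, hcost, hle⟩ := hS.lower
    have hn₀ : Γ₀.BoundedBy n := fun i hi => by
      have := hn i hi
      simpa [Ctx.bang] using this
    obtain ⟨d', w', hd', hw', hder⟩ := ih (D := D - 1) (by omega) hSD hn₀
    refine ⟨d' + 1, r * w', by omega, ?_, ?_⟩
    · have h1 : (Finset.range n).sum cost = r * (Finset.range n).sum cost' := by
        rw [Finset.mul_sum]
        exact Finset.sum_congr rfl fun i _ => hcost i
      rw [h1]
      nlinarith
    · obtain ⟨m, hm⟩ := hS.bdd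
      exact (MTyping.sp hder rfl).extend (fun i' hi' => hS.iUnion_lower_le hSD hle i' hi')
        (Ctx.iUnion_boundedBy hm)
  | @allI d w Γ Δc M A h₀ hΔc ih =>
    rw [hΔc] at ih
    have hn' : Γ.shift.BoundedBy n := fun i hi => by simp [Ctx.shift, hn i hi]
    obtain ⟨d', w', hd', hw', hder⟩ := ih hd hS.shiftT hn'
    rw [hS.iUnion_shift] at hder
    exact ⟨d', w', hd', hw', MTyping.allI hder rfl⟩
  | @allE d w Γ M B A h₀ ih =>
    obtain ⟨d', w', hd', hw', hder⟩ := ih hd hS hn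
    exact ⟨d', w', hd', hw', MTyping.allE A hder⟩

end MTyping

end STA

end Literature.Computability.ImplicitComplexity
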